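import Summits.AtomisticToContinuum.HydrodynamicLimit.Theorems.JaynesSqueezeHardSphereLDAConvexity
import HarnessLib

/-!
# Hard-sphere local density approximation, Ib: the one-point (insertion) bound

Helper file for the support item `HardSphereLDA` (stmt-AtomisticToContinuum-13459) of route
`JaynesSqueeze`. For `n` hard spheres of diameter `0 ≤ ε < 1/2` on `𝕋³` with a measurable
activity `0 ≤ a ≤ A` (`Z(a) = posPartition a ε n`):

* `posPartition_inv_mul_integral_abs_le` — **the one-point bound**: for every label `i` and
  bounded measurable `ψ`, `E_a[|ψ(xᵢ)|] ≤ (∫ a|ψ|) / (∫ a − n A v₁ ε³)` as soon as the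
  denominator is positive (`v₁ ε³` bounds the volume of a minimal-image ball of radius `ε`,
  `volume_ball_le`): integrating out `xᵢ` (Tonelli, `HardCoreCanonical.lintegral_pi_eq_lintegral_update`)
  the weight of the remaining particles factors (`posWeight_update_le`, `posWeight_update_eq`),
  and the inserted particle only has to avoid `n` balls (`lintegral_good_ge`);
* `posPartition_inv_mul_integral_sum_abs_le` — summed over the labels:
  `E_a[∑ᵢ |ψ(xᵢ)|] ≤ n (∫ a|ψ|) / (∫ a − n A v₁ ε³)`.

No definitions. prover-pitem-stmt-AtomisticToContinuum-13459-0.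
-/

noncomputable section

namespace Summit.AtomisticToContinuum.HydrodynamicLimit.Theorems.HardSphereLDA

open MeasureTheory Filter Set Topology
open scoped ENNReal
open Literature.MathematicalPhysics.KineticTheory Literature.Analysis.FluidPDE

variable {a : T3 → ℝ} {ε : ℝ} {n : ℕ}

/-! ### Integrating out one particle: the one-point (insertion) bound -/

/-- The non-overlap constraints NOT involving the label `i`. [folklore] -/
theorem measurableSet_reducedDomain (ε : ℝ) (n : ℕ) (i : Fin n) :
    MeasurableSet {x : Fin n → T3 | ∀ j k : Fin n, j ≠ k → j ≠ i → k ≠ i →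
      ε ≤ Literature.Analysis.FluidPDE.Torus.euclidDist (x j) (x k)} := by
  have h : {x : Fin n → T3 | ∀ j k : Fin n, j ≠ k → j ≠ i → k ≠ i →
      ε ≤ Literature.Analysis.FluidPDE.Torus.euclidDist (x j) (x k)} =
      ⋂ j, ⋂ k, {x | j ≠ k → j ≠ i → k ≠ i → ε ≤ Literature.Analysis.FluidPDE.Torus.euclidDist (x j) (x k)} := by
    ext x; simp
  rw [h]
  refine MeasurableSet.iInter fun j => MeasurableSet.iInter fun k => ?_
  by_cases hjk : j ≠ k ∧ j ≠ i ∧ k ≠ i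
  · have : {x : Fin n → T3 | j ≠ k → j ≠ i → k ≠ i → ε ≤ Literature.Analysis.FluidPDE.Torus.euclidDist (x j) (x k)} =
        {x | ε ≤ Literature.Analysis.FluidPDE.Torus.euclidDist (x j) (x k)} := by
      ext x; simp [hjk.1, hjk.2.1, hjk.2.2]
    rw [this]
    exact measurableSet_le measurable_const (continuous_euclidDist_apply j k).measurable
  · have : {x : Fin n → T3 | j ≠ k → j ≠ i → k ≠ i → ε ≤ Literature.Analysis.FluidPDE.Torus.euclidDist (x j) (x k)} =
        Set.univ := by
      ext x
      simp only [mem_setOf_eq, mem_univ, iff_true]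
      intro h1 h2 h3
      exact absurd ⟨h1, h2, h3⟩ hjk
    rw [this]
    exact MeasurableSet.univ

/-- The product of the activities of the particles other than `i` is unchanged by moving `i`.
[folklore] -/
theorem prod_erase_update (a : T3 → ℝ) (i : Fin n) (x : Fin n → T3) (y : T3) :
    ∏ j ∈ Finset.univ.erase i, a (Function.update x i y j) = ∏ j ∈ Finset.univ.erase i, a (x j) := by
  refine Finset.prod_congr rfl fun j hj => ?_
  rw [Function.update_of_ne (Finset.ne_of_mem_erase hj)]

/-- **Upper factorisation.** Moving particle `i` to `y`, the position weight is at most the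
reduced weight of the others times `a(y)`:
`posWeight a (update x i y) ≤ 𝟙[others don't overlap] ∏_{j ≠ i} a(xⱼ) · a(y)`. [folklore] -/
theorem posWeight_update_le (ha0 : ∀ y, 0 ≤ a y) (ε : ℝ) (i : Fin n) (x : Fin n → T3) (y : T3) :
    posWeight a ε n (Function.update x i y) ≤
      {x : Fin n → T3 | ∀ j k : Fin n, j ≠ k → j ≠ i → k ≠ i →
          ε ≤ Literature.Analysis.FluidPDE.Torus.euclidDist (x j) (x k)}.indicator
        (fun x => ∏ j ∈ Finset.univ.erase i, a (x j)) x * a y := by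
  have hprod : ∏ j, a (Function.update x i y j) = a y * ∏ j ∈ Finset.univ.erase i, a (x j) := by
    rw [← Finset.mul_prod_erase _ _ (Finset.mem_univ i), Function.update_self, prod_erase_update]
  unfold posWeight
  by_cases hx : Function.update x i y ∈ posDomain ε n
  · rw [indicator_of_mem hx, hprod]
    have hx' : x ∈ {x : Fin n → T3 | ∀ j k : Fin n, j ≠ k → j ≠ i → k ≠ i →
        ε ≤ Literature.Analysis.FluidPDE.Torus.euclidDist (x j) (x k)} := by
      intro j k hjk hji hki
      have h := hx j k hjk
      rwa [Function.update_of_ne hji, Function.update_of_ne hki] at h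
    rw [indicator_of_mem hx', mul_comm]
  · rw [indicator_of_notMem hx]
    exact mul_nonneg (indicator_nonneg (fun z _ => Finset.prod_nonneg fun j _ => ha0 _) _) (ha0 y)

/-- **Exact factorisation on the good set.** If `y` keeps distance `≥ ε` from all the other
particles, the position weight of `update x i y` IS the reduced weight times `a(y)`. [folklore] -/
theorem posWeight_update_eq (ε : ℝ) (i : Fin n) (x : Fin n → T3) {y : T3}
    (hy : ∀ j : Fin n, j ≠ i → ε ≤ Literature.Analysis.FluidPDE.Torus.euclidDist y (x j)) :
    posWeight a ε n (Function.update x i y) =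
      {x : Fin n → T3 | ∀ j k : Fin n, j ≠ k → j ≠ i → k ≠ i →
          ε ≤ Literature.Analysis.FluidPDE.Torus.euclidDist (x j) (x k)}.indicator
        (fun x => ∏ j ∈ Finset.univ.erase i, a (x j)) x * a y := by
  have hprod : ∏ j, a (Function.update x i y j) = a y * ∏ j ∈ Finset.univ.erase i, a (x j) := by
    rw [← Finset.mul_prod_erase _ _ (Finset.mem_univ i), Function.update_self, prod_erase_update]
  unfold posWeight
  by_cases hx' : x ∈ {x : Fin n → T3 | ∀ j k : Fin n, j ≠ k → j ≠ i → k ≠ i →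
      ε ≤ Literature.Analysis.FluidPDE.Torus.euclidDist (x j) (x k)}
  · have hx : Function.update x i y ∈ posDomain ε n := by
      intro j k hjk
      by_cases hji : j = i
      · subst hji
        rw [Function.update_self, Function.update_of_ne (Ne.symm hjk)]
        exact hy k (Ne.symm hjk)
      · by_cases hki : k = i
        · subst hki
          rw [Function.update_self, Function.update_of_ne hji,
            Literature.Analysis.FluidPDE.Torus.euclidDist_comm]
          exact hy j hji
        · rw [Function.update_of_ne hji, Function.update_of_ne hki]
          exact hx' j k hjk hji hki
    rw [indicator_of_mem hx, indicator_of_mem hx', hprod, mul_comm]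
  · have hx : Function.update x i y ∉ posDomain ε n := by
      intro hx
      apply hx'
      intro j k hjk hji hki
      have h := hx j k hjk
      rwa [Function.update_of_ne hji, Function.update_of_ne hki] at h
    rw [indicator_of_notMem hx, indicator_of_notMem hx', zero_mul]

/-- The volume of a minimal-image ball of radius `ε < 1/2` in `𝕋³` is at most `v₁ ε³`. [folklore] -/
theorem volume_ball_le {ε : ℝ} (hε : 0 ≤ ε) (hε2 : ε < 1 / 2) (z : T3) :
    volume {y : T3 | Literature.Analysis.FluidPDE.Torus.euclidDist y z < ε} ≤ ENNReal.ofReal (v₁ * ε ^ 3) := by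
  rw [Literature.Analysis.FluidPDE.Torus.volume_euclidDist_lt hε2, Measure.addHaar_ball volume _ hε,
    finrank_euclideanSpace, Fintype.card_fin, mul_comm v₁, ENNReal.ofReal_mul (pow_nonneg hε 3)]
  gcongr
  rw [v₁, ENNReal.ofReal_toReal measure_ball_lt_top.ne]

/-- **The inserted particle only has to avoid `n` balls**: for a measurable activity `0 ≤ a ≤ A`
and `0 ≤ ε < 1/2`, the `a`-mass of the points of `𝕋³` at distance `≥ ε` from all `xⱼ`, `j ≠ i`, is
at least `∫ a − n A v₁ ε³`. [folklore] -/
theorem lintegral_good_ge (ha : Measurable a) (ha0 : ∀ y, 0 ≤ a y) {A : ℝ} (hA : ∀ y, a y ≤ A)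
    {ε : ℝ} (hε : 0 ≤ ε) (hε2 : ε < 1 / 2) (i : Fin n) (x : Fin n → T3) :
    ENNReal.ofReal ((∫ y, a y) - n * A * (v₁ * ε ^ 3)) ≤
      ∫⁻ y in {y : T3 | ∀ j : Fin n, j ≠ i → ε ≤ Literature.Analysis.FluidPDE.Torus.euclidDist y (x j)},
        ENNReal.ofReal (a y) := by
  set G : Set T3 := {y : T3 | ∀ j : Fin n, j ≠ i → ε ≤ Literature.Analysis.FluidPDE.Torus.euclidDist y (x j)}
    with hG
  have hA0 : 0 ≤ A := (ha0 0).trans (hA 0)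
  have hGc : Gᶜ ⊆ ⋃ j : Fin n, {y : T3 | Literature.Analysis.FluidPDE.Torus.euclidDist y (x j) < ε} := by
    intro y hy
    simp only [hG, mem_compl_iff, mem_setOf_eq, not_forall, not_le, exists_prop] at hy
    obtain ⟨j, -, hj⟩ := hy
    exact mem_iUnion.2 ⟨j, hj⟩
  have hGm : MeasurableSet G := by
    have : G = ⋂ j : Fin n, {y | j ≠ i → ε ≤ Literature.Analysis.FluidPDE.Torus.euclidDist y (x j)} := by
      ext y; simp [hG]
    rw [this]
    refine MeasurableSet.iInter fun j => ?_
    by_cases hji : j ≠ i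
    · have : {y : T3 | j ≠ i → ε ≤ Literature.Analysis.FluidPDE.Torus.euclidDist y (x j)} =
          {y | ε ≤ Literature.Analysis.FluidPDE.Torus.euclidDist y (x j)} := by ext y; simp [hji]
      rw [this]
      exact measurableSet_le measurable_const
        ((continuous_euclidDist_prod.comp (continuous_id.prodMk continuous_const)).measurable)
    · have : {y : T3 | j ≠ i → ε ≤ Literature.Analysis.FluidPDE.Torus.euclidDist y (x j)} = univ := by
        ext y; simp [hji]
      rw [this]; exact MeasurableSet.univ
  -- the mass of the bad set
  have hbad : ∫⁻ y in Gᶜ, ENNReal.ofReal (a y) ≤ ENNReal.ofReal (n * A * (v₁ * ε ^ 3)) := by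
    calc ∫⁻ y in Gᶜ, ENNReal.ofReal (a y) ≤ ∫⁻ _y in Gᶜ, ENNReal.ofReal A :=
          lintegral_mono fun y => ENNReal.ofReal_le_ofReal (hA y)
      _ = ENNReal.ofReal A * volume Gᶜ := by rw [setLIntegral_const]
      _ ≤ ENNReal.ofReal A * ∑ j : Fin n, volume {y : T3 | Literature.Analysis.FluidPDE.Torus.euclidDist y (x j) < ε} := by
          gcongr
          exact (measure_mono hGc).trans (measure_iUnion_fintype_le _ _)
      _ ≤ ENNReal.ofReal A * ∑ _j : Fin n, ENNReal.ofReal (v₁ * ε ^ 3) := by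
          gcongr with j
          exact volume_ball_le hε hε2 _
      _ = ENNReal.ofReal (n * A * (v₁ * ε ^ 3)) := by
          rw [Finset.sum_const, Finset.card_univ, Fintype.card_fin, nsmul_eq_mul,
            ← ENNReal.ofReal_natCast, ← ENNReal.ofReal_mul (Nat.cast_nonneg _),
            ← ENNReal.ofReal_mul hA0]
          ring_nf
  -- total mass
  have htot : ∫⁻ y, ENNReal.ofReal (a y) = ENNReal.ofReal (∫ y, a y) :=
    (ofReal_integral_eq_lintegral_ofReal (integrable_T3_of_abs_le ha fun y => by
      rw [abs_of_nonneg (ha0 y)]; exact hA y) (Eventually.of_forall ha0)).symm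
  have hsplit := lintegral_add_compl (μ := (volume : Measure T3)) (fun y => ENNReal.ofReal (a y)) hGm
  rw [htot] at hsplit
  calc ENNReal.ofReal ((∫ y, a y) - n * A * (v₁ * ε ^ 3))
      = ENNReal.ofReal (∫ y, a y) - ENNReal.ofReal (n * A * (v₁ * ε ^ 3)) :=
        ENNReal.ofReal_sub _ (by have := v₁_pos; positivity)
    _ ≤ ENNReal.ofReal (∫ y, a y) - ∫⁻ y in Gᶜ, ENNReal.ofReal (a y) := tsub_le_tsub_left hbad _
    _ ≤ ∫⁻ y in G, ENNReal.ofReal (a y) := by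
        rw [← hsplit, ENNReal.add_sub_cancel_right]
        exact ne_top_of_le_ne_top ENNReal.ofReal_ne_top hbad

/-- **The one-point (insertion) bound.** For a measurable activity `0 ≤ a ≤ A`, `0 ≤ ε < 1/2`, a
label `i` and a bounded measurable `ψ`, if `n A v₁ ε³ < ∫ a` then the canonical Gibbs expectation of
`|ψ(xᵢ)|` satisfies `Z(a)⁻¹ ∫ 𝟙 ∏a · |ψ(xᵢ)| ≤ (∫ a |ψ|) / (∫ a − n A v₁ ε³)`. [folklore] -/
theorem posPartition_inv_mul_integral_abs_le (ha : Measurable a) (ha0 : ∀ y, 0 ≤ a y) {A : ℝ}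
    (hA : ∀ y, a y ≤ A) {ε : ℝ} (hε : 0 ≤ ε) (hε2 : ε < 1 / 2) {ψ : T3 → ℝ} (hψ : Measurable ψ)
    {C : ℝ} (hψC : ∀ y, |ψ y| ≤ C) (i : Fin n) (hgap : n * A * (v₁ * ε ^ 3) < ∫ y, a y) :
    (posPartition a ε n)⁻¹ * ∫ x, posWeight a ε n x * |ψ (x i)| ≤
      (∫ y, a y * |ψ y|) / ((∫ y, a y) - n * A * (v₁ * ε ^ 3)) := by
  have hA0 : 0 ≤ A := (ha0 0).trans (hA 0)
  have hC : 0 ≤ C := (abs_nonneg _).trans (hψC 0)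
  set m : ℝ := (∫ y, a y) - n * A * (v₁ * ε ^ 3) with hm
  have hm0 : 0 < m := by rw [hm]; linarith
  -- the reduced weight of the particles other than `i`
  set D : Set (Fin n → T3) := {x : Fin n → T3 | ∀ j k : Fin n, j ≠ k → j ≠ i → k ≠ i →
      ε ≤ Literature.Analysis.FluidPDE.Torus.euclidDist (x j) (x k)} with hD
  set RW : (Fin n → T3) → ℝ := D.indicator fun x => ∏ j ∈ Finset.univ.erase i, a (x j) with hRW
  have hRW0 : ∀ x, 0 ≤ RW x := fun x =>
    indicator_nonneg (fun z _ => Finset.prod_nonneg fun j _ => ha0 _) _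
  have hRWm : Measurable RW :=
    (Finset.measurable_prod _ fun j _ => ha.comp (measurable_pi_apply j)).indicator
      (measurableSet_reducedDomain ε n i)
  set ZR : ℝ≥0∞ := ∫⁻ x, ENNReal.ofReal (RW x) with hZR
  -- numerator and denominator as iterated integrals
  have hwm : Measurable (posWeight a ε n) := measurable_posWeight_of_measurable ha ε n
  have hψi : Measurable fun x : Fin n → T3 => |ψ (x i)| := (hψ.comp (measurable_pi_apply i)).abs
  have hNm : Measurable fun x : Fin n → T3 => ENNReal.ofReal (posWeight a ε n x * |ψ (x i)|) :=
    (hwm.mul hψi).ennreal_ofReal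
  have hvol : (volume : Measure (Fin n → T3)) = Measure.pi fun _ : Fin n => (volume : Measure T3) :=
    volume_pi
  -- numerator ≤ ZR · ∫ a|ψ|
  have hnum : ∫⁻ x, ENNReal.ofReal (posWeight a ε n x * |ψ (x i)|) ≤
      ZR * ENNReal.ofReal (∫ y, a y * |ψ y|) := by
    have haψm : Measurable fun y => a y * |ψ y| := ha.mul hψ.abs
    have haψm' : Measurable fun y => ENNReal.ofReal (a y * |ψ y|) := haψm.ennreal_ofReal
    have hI : ∫⁻ y, ENNReal.ofReal (a y * |ψ y|) = ENNReal.ofReal (∫ y, a y * |ψ y|) :=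
      (ofReal_integral_eq_lintegral_ofReal (integrable_T3_of_abs_le haψm (K := A * C) fun y => by
        rw [abs_mul, abs_abs, abs_of_nonneg (ha0 y)]
        exact mul_le_mul (hA y) (hψC y) (abs_nonneg _) hA0)
        (Eventually.of_forall fun y => mul_nonneg (ha0 y) (abs_nonneg _))).symm
    rw [hvol, Literature.MathematicalPhysics.StatisticalMechanics.lintegral_pi_eq_lintegral_update
      (volume : Measure T3) i hNm, ← hvol, ← hI]
    calc ∫⁻ x, ∫⁻ y, ENNReal.ofReal (posWeight a ε n (Function.update x i y) * |ψ (Function.update x i y i)|)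
        ≤ ∫⁻ x, ENNReal.ofReal (RW x) * ∫⁻ y, ENNReal.ofReal (a y * |ψ y|) := by
          refine lintegral_mono fun x => ?_
          rw [← lintegral_const_mul _ haψm']
          refine lintegral_mono fun y => ?_
          rw [Function.update_self, ← ENNReal.ofReal_mul (hRW0 x)]
          refine ENNReal.ofReal_le_ofReal ?_
          rw [← mul_assoc]
          exact mul_le_mul_of_nonneg_right (posWeight_update_le ha0 ε i x y) (abs_nonneg _)
      _ = ZR * ∫⁻ y, ENNReal.ofReal (a y * |ψ y|) := by
          rw [lintegral_mul_const _ hRWm.ennreal_ofReal]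
  -- denominator ≥ ZR · m
  have hden : ZR * ENNReal.ofReal m ≤ ENNReal.ofReal (posPartition a ε n) := by
    rw [ofReal_posPartition_of_measurable ha ha0 hA, hvol,
      Literature.MathematicalPhysics.StatisticalMechanics.lintegral_pi_eq_lintegral_update
        (volume : Measure T3) i hwm.ennreal_ofReal, ← hvol, hZR, ← lintegral_mul_const _ hRWm.ennreal_ofReal]
    refine lintegral_mono fun x => ?_
    set G : Set T3 := {y : T3 | ∀ j : Fin n, j ≠ i → ε ≤ Literature.Analysis.FluidPDE.Torus.euclidDist y (x j)}
      with hG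
    calc ENNReal.ofReal (RW x) * ENNReal.ofReal m
        ≤ ENNReal.ofReal (RW x) * ∫⁻ y in G, ENNReal.ofReal (a y) := by
          gcongr
          exact lintegral_good_ge ha ha0 hA hε hε2 i x
      _ = ∫⁻ y in G, ENNReal.ofReal (RW x * a y) := by
          rw [← lintegral_const_mul _ ha.ennreal_ofReal]
          refine lintegral_congr fun y => ?_
          rw [ENNReal.ofReal_mul (hRW0 x)]
      _ = ∫⁻ y in G, ENNReal.ofReal (posWeight a ε n (Function.update x i y)) := by
          refine setLIntegral_congr_fun_ae ?_ (Eventually.of_forall fun y hy => ?_)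
          · have : G = ⋂ j : Fin n, {y | j ≠ i → ε ≤ Literature.Analysis.FluidPDE.Torus.euclidDist y (x j)} := by
              ext y; simp [hG]
            rw [this]
            refine MeasurableSet.iInter fun j => ?_
            by_cases hji : j ≠ i
            · have : {y : T3 | j ≠ i → ε ≤ Literature.Analysis.FluidPDE.Torus.euclidDist y (x j)} =
                  {y | ε ≤ Literature.Analysis.FluidPDE.Torus.euclidDist y (x j)} := by ext y; simp [hji]
              rw [this]
              exact measurableSet_le measurable_const
                ((continuous_euclidDist_prod.comp (continuous_id.prodMk continuous_const)).measurable)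
            · have : {y : T3 | j ≠ i → ε ≤ Literature.Analysis.FluidPDE.Torus.euclidDist y (x j)} = univ := by
                ext y; simp [hji]
              rw [this]; exact MeasurableSet.univ
          · rw [posWeight_update_eq ε i x hy]
      _ ≤ ∫⁻ y, ENNReal.ofReal (posWeight a ε n (Function.update x i y)) := setLIntegral_le_lintegral _ _
  -- combine
  have hZpos : 0 < posPartition a ε n ∨ posPartition a ε n = 0 :=
    (posPartition_nonneg ha0 ε n).lt_or_eq.imp_right Eq.symm
  have hInn : 0 ≤ ∫ y, a y * |ψ y| := integral_nonneg fun y => mul_nonneg (ha0 y) (abs_nonneg _)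
  rcases hZpos with hZ | hZ
  · -- `Z > 0`
    have hZR_top : ZR ≠ ∞ := by
      intro htop
      rw [htop, ENNReal.top_mul (ENNReal.ofReal_pos.2 hm0).ne'] at hden
      exact ENNReal.ofReal_ne_top (top_le_iff.1 hden)
    have hnumR : ∫ x, posWeight a ε n x * |ψ (x i)| ≤ ZR.toReal * ∫ y, a y * |ψ y| := by
      have h1 : ∫ x, posWeight a ε n x * |ψ (x i)| =
          (∫⁻ x, ENNReal.ofReal (posWeight a ε n x * |ψ (x i)|)).toReal := by
        rw [integral_eq_lintegral_of_nonneg_ae (Eventually.of_forall fun x =>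
          mul_nonneg (posWeight_nonneg ha0 ε x) (abs_nonneg _)) (hwm.mul hψi).aestronglyMeasurable]
      rw [h1, ← ENNReal.toReal_ofReal hInn, ← ENNReal.toReal_mul]
      exact ENNReal.toReal_mono (ENNReal.mul_ne_top hZR_top ENNReal.ofReal_ne_top) hnum
    have hdenR : ZR.toReal * m ≤ posPartition a ε n := by
      have h := ENNReal.toReal_mono ENNReal.ofReal_ne_top hden
      rwa [ENNReal.toReal_mul, ENNReal.toReal_ofReal hm0.le,
        ENNReal.toReal_ofReal (posPartition_nonneg ha0 ε n)] at h
    have hZRle : ZR.toReal ≤ posPartition a ε n / m := by rw [le_div_iff₀ hm0]; exact hdenR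
    calc (posPartition a ε n)⁻¹ * ∫ x, posWeight a ε n x * |ψ (x i)|
        ≤ (posPartition a ε n)⁻¹ * (ZR.toReal * ∫ y, a y * |ψ y|) :=
          mul_le_mul_of_nonneg_left hnumR (inv_nonneg.2 hZ.le)
      _ ≤ (posPartition a ε n)⁻¹ * ((posPartition a ε n / m) * ∫ y, a y * |ψ y|) :=
          mul_le_mul_of_nonneg_left (mul_le_mul_of_nonneg_right hZRle hInn) (inv_nonneg.2 hZ.le)
      _ = (∫ y, a y * |ψ y|) / m := by
          field_simp
  · -- `Z = 0`: the left side vanishes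
    rw [hZ, inv_zero, zero_mul]
    exact div_nonneg hInn hm0.le

/-- **The one-point bound, summed over the labels**: `Z(a)⁻¹ ∫ 𝟙 ∏a · ∑ᵢ |ψ(xᵢ)| ≤
n (∫ a|ψ|) / (∫ a − n A v₁ ε³)`. [folklore] -/
theorem posPartition_inv_mul_integral_sum_abs_le (ha : Measurable a) (ha0 : ∀ y, 0 ≤ a y) {A : ℝ}
    (hA : ∀ y, a y ≤ A) {ε : ℝ} (hε : 0 ≤ ε) (hε2 : ε < 1 / 2) {ψ : T3 → ℝ} (hψ : Measurable ψ)
    {C : ℝ} (hψC : ∀ y, |ψ y| ≤ C) (hgap : n * A * (v₁ * ε ^ 3) < ∫ y, a y) :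
    (posPartition a ε n)⁻¹ * ∫ x, posWeight a ε n x * ∑ i, |ψ (x i)| ≤
      n * ((∫ y, a y * |ψ y|) / ((∫ y, a y) - n * A * (v₁ * ε ^ 3))) := by
  have hA0 : 0 ≤ A := (ha0 0).trans (hA 0)
  have hC : 0 ≤ C := (abs_nonneg _).trans (hψC 0)
  have hwm : Measurable (posWeight a ε n) := measurable_posWeight_of_measurable ha ε n
  have hint : ∀ i : Fin n, Integrable fun x : Fin n → T3 => posWeight a ε n x * |ψ (x i)| := fun i =>
    integrable_config_of_abs_le (hwm.mul (hψ.comp (measurable_pi_apply i)).abs) (K := A ^ n * C) fun x => by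
      rw [abs_mul, abs_abs]
      exact mul_le_mul (abs_posWeight_le ha0 hA ε x) (hψC _) (abs_nonneg _) (pow_nonneg hA0 n)
  have hsum : ∫ x, posWeight a ε n x * ∑ i, |ψ (x i)| = ∑ i, ∫ x, posWeight a ε n x * |ψ (x i)| := by
    rw [← integral_finsetSum _ fun i _ => hint i]
    refine integral_congr_ae (Eventually.of_forall fun x => ?_)
    simp only [Finset.mul_sum]
  rw [hsum, Finset.mul_sum]
  calc ∑ i, (posPartition a ε n)⁻¹ * ∫ x, posWeight a ε n x * |ψ (x i)|
      ≤ ∑ _i : Fin n, (∫ y, a y * |ψ y|) / ((∫ y, a y) - n * A * (v₁ * ε ^ 3)) :=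
        Finset.sum_le_sum fun i _ => posPartition_inv_mul_integral_abs_le ha ha0 hA hε hε2 hψ hψC i hgap
    _ = _ := by simp

end Summit.AtomisticToContinuum.HydrodynamicLimit.Theorems.HardSphereLDA

end
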